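import Summits.Ventures.DiscreteObjects.MOLS.NetCounts

/-!
# Deficiency two (Shrikhande 1961): `n - 3` MOLS(n) complete for `n ≥ 5`; PP(12) ⇔ 9 MOLS(12); N(10) ≤ 6 modulo Lam (kernel)
Framing: lottery ticket; floor = certified bounds/negative ranges.

Cell pub-namedobj (venture DiscreteObjects), target (M), designs gen 9.  Shrikhande's theorem (Sankhyā A 23 (1961) 115–116; Bruck
1963 Thm 4.3, d = 2): for `n > 4`, `n - 3` pairwise orthogonal Latin squares of order `n` extend to a complete set of `n - 1`.  Proof
formalised (graph-theoretic: the unjoined graph is pseudo-`L₂(n)` by `NetCounts`; Shrikhande's 1959 local argument identifies it):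
**`local_structure`** — for `n ≥ 5` the cells unjoined to `x` split into two cliques of `n - 1` mutually unjoined cells with no
unjoined pair across; `exists_clique`, `existsUnique_nbr_K` — an `n`-clique `K` exists and every other cell is unjoined to exactly
one cell of `K`; **`exists_completion_two`** — `S y :=` the row of that cell is a Latin square orthogonal to the given ones; then
`NetCompletion.exists_extension`.  Consequences: **`existsPlane_iff_MOLS_deficiency_two`** (`5 ≤ n`: PP(n) ⇔ `n - 3` MOLS(n)),
**`existsPlaneOrder12_iff_nine_MOLS`** (target (M-b): NINE squares suffice), **`card_MOLS10_le_six_of_noPlane10`** — the printed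
upper floor `N(10) ≤ 6`, in the kernel modulo only the hypothesis ¬PP(10) (Lam–Thiel–Swiercz 1989, computer proof, not vendored).
Classical; formalisation ours; no `sorry`.
-/

namespace Summit.Ventures.DiscreteObjects.MOLS

open Function Finset Literature.Combinatorics.Designs.LatinSquares
open scoped Classical

section Two

variable {ι : Type*} {n : ℕ} {Ls : ι → Fin n → Fin n → Fin n}

/-- a set of mutually unjoined cells (a clique of the unjoined graph) -/
def IsClique (Ls : ι → Fin n → Fin n → Fin n) (Q : Finset (Fin n × Fin n)) : Prop :=
  ∀ a ∈ Q, ∀ b ∈ Q, a ≠ b → b ∈ U Ls a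

/-- subsets of cliques are cliques -/
theorem IsClique.mono {Q R : Finset (Fin n × Fin n)} (hQ : IsClique Ls Q) (hRQ : R ⊆ Q) : IsClique Ls R :=
  fun a ha b hb hab => hQ a (hRQ ha) b (hRQ hb) hab

/-- a clique of `n - 1` cells inside `A ∪ B` (cliques without unjoined pairs across, `n ≥ 3`) is `A` or `B` -/
theorem clique_eq_side {x : Fin n × Fin n} {A B Q : Finset (Fin n × Fin n)} (hAB : A ∪ B = U Ls x)
    (hAc : A.card = n - 1) (hBc : B.card = n - 1) (hcross : ∀ a ∈ A, ∀ b ∈ B, b ∉ U Ls a)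
    (hQ : IsClique Ls Q) (hQsub : Q ⊆ U Ls x) (hQc : Q.card = n - 1) : Q = A ∨ Q = B := by
  by_cases hQA : Q ⊆ A
  · exact Or.inl (eq_of_subset_of_card_le hQA (by rw [hAc, hQc]))
  · right
    obtain ⟨b, hbQ, hbA⟩ := not_subset.mp hQA
    have hbB : b ∈ B := by
      have := hQsub hbQ; rw [← hAB, mem_union] at this
      exact this.resolve_left hbA
    refine eq_of_subset_of_card_le (fun a haQ => ?_) (by rw [hBc, hQc])
    have := hQsub haQ; rw [← hAB, mem_union] at this
    rcases this with haA | haB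
    · have hab : a ≠ b := by rintro rfl; exact hbA haA
      exact absurd (hQ a haQ b hbQ hab) (hcross a haA b hbB)
    · exact haB

/-- distinct cells of a clique lie in distinct rows -/
theorem row_injOn_clique (K : Finset (Fin n × Fin n)) (hK : IsClique Ls K) {x x' : Fin n × Fin n} (hx : x ∈ K)
    (hx' : x' ∈ K) (h : x.1 = x'.1) : x = x' := by
  by_contra hxx
  exact mem_U.mp (hK x hx x' hx' hxx) ⟨Sum.inr false, by simpa [coord, val] using h.symm⟩

variable [Fintype ι]
variable (hL : ∀ k, IsLatinSquare (Ls k)) (hO : ∀ k k', k ≠ k' → IsOrthogonalMate (Ls k) (Ls k'))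
  (hC : Fintype.card ι + 3 = n) (hn : 5 ≤ n)
include hL hO hC hn

/-- **Shrikhande's local argument.**  For `n ≥ 5` the cells unjoined to `x` are the disjoint union of two cliques of `n - 1`
mutually unjoined cells, with no unjoined pair across. -/
theorem local_structure (x : Fin n × Fin n) :
    ∃ A B : Finset (Fin n × Fin n), A ∪ B = U Ls x ∧ Disjoint A B ∧ A.card = n - 1 ∧ B.card = n - 1 ∧
      IsClique Ls A ∧ IsClique Ls B ∧ ∀ a ∈ A, ∀ b ∈ B, b ∉ U Ls a := by
  have hUx := card_U hL hO hC x
  obtain ⟨y, hy⟩ : (U Ls x).Nonempty := by rw [← card_pos, hUx]; omega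
  have hxy : ¬ JE Ls x y := mem_U.mp hy
  have hyx : x ∈ U Ls y := mem_U_comm.mp hy
  set A : Finset (Fin n × Fin n) := insert y (U Ls x ∩ U Ls y) with hA
  set B : Finset (Fin n × Fin n) := U Ls x \ A with hB
  have hAsub : A ⊆ U Ls x := by
    intro a ha
    rcases mem_insert.mp ha with rfl | ha
    · exact hy
    · exact (mem_inter.mp ha).1
  have hAcard : A.card = n - 1 := by
    rw [hA, card_insert_of_notMem (fun h => not_mem_U_self y (mem_inter.mp h).2)]
    have := card_U_inter_of_unjoined hL hO hC hxy
    omega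
  have hBcard : B.card = n - 1 := by
    rw [hB, card_sdiff_of_subset hAsub, hUx, hAcard]; omega
  have hAB : A ∪ B = U Ls x := by rw [hB, union_sdiff_of_subset hAsub]
  have hdisj : Disjoint A B := by rw [hB]; exact disjoint_sdiff
  have hBmem : ∀ {b}, b ∈ B → b ∈ U Ls x ∧ b ≠ y ∧ b ∉ U Ls y := by
    intro b hb
    rw [hB, mem_sdiff, hA, mem_insert, mem_inter, not_or, not_and] at hb
    exact ⟨hb.1, hb.2.1, hb.2.2 hb.1⟩
  -- (i) a cell of B has at most one unjoined partner in A
  have hBA : ∀ {b}, b ∈ B → (A.filter fun a => a ∈ U Ls b).card ≤ 1 := by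
    intro b hb
    obtain ⟨hbx, hby, hbUy⟩ := hBmem hb
    have hjoined : JE Ls y b := by rwa [mem_U, not_not] at hbUy
    have h2 := card_U_inter_of_joined hL hO hC (Ne.symm hby) hjoined
    have hxin : x ∈ U Ls y ∩ U Ls b := mem_inter.mpr ⟨hyx, mem_U_comm.mp hbx⟩
    have hsub : (A.filter fun a => a ∈ U Ls b) ⊆ (U Ls y ∩ U Ls b).erase x := by
      intro a ha
      rw [mem_filter] at ha
      obtain ⟨haA, hab⟩ := ha
      rcases mem_insert.mp haA with rfl | haI
      · exact absurd (mem_U_comm.mp hab) hbUy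
      · obtain ⟨hax, hay⟩ := mem_inter.mp haI
        refine mem_erase.mpr ⟨?_, mem_inter.mpr ⟨hay, hab⟩⟩
        rintro rfl; exact not_mem_U_self _ hax
    have := card_le_card hsub
    rw [card_erase_of_mem hxin, h2] at this
    exact this
  -- (ii) a cell of B is joined to at most one other cell of B
  have hBB : ∀ {b}, b ∈ B → ((B.erase b).filter fun z => z ∉ U Ls b).card ≤ 1 := by
    intro b hb
    obtain ⟨hbx, -, -⟩ := hBmem hb
    have hdeg := card_U_inter_of_unjoined hL hO hC (mem_U.mp hbx)   -- |U x ∩ U b| + 2 = n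
    have hsplit : (U Ls x ∩ U Ls b).card = (A.filter fun a => a ∈ U Ls b).card + (B.filter fun z => z ∈ U Ls b).card := by
      rw [← card_union_of_disjoint (disjoint_filter_filter hdisj), ← filter_union, hAB, filter_mem_eq_inter]
    have h1 := hBA hb
    have h3 : (B.filter fun z => z ∈ U Ls b) ⊆ B.erase b := by
      intro z hz; rw [mem_filter] at hz
      exact mem_erase.mpr ⟨by rintro rfl; exact not_mem_U_self _ hz.2, hz.1⟩
    have h4 := card_filter_add_card_filter_not (s := B.erase b) (fun z => z ∈ U Ls b)
    have h5 : ((B.erase b).filter fun z => z ∈ U Ls b) = (B.filter fun z => z ∈ U Ls b) := by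
      ext z; simp only [mem_filter, mem_erase]
      constructor
      · rintro ⟨⟨-, hz⟩, hu⟩; exact ⟨hz, hu⟩
      · rintro ⟨hz, hu⟩; exact ⟨⟨by rintro rfl; exact not_mem_U_self _ hu, hz⟩, hu⟩
    rw [h5, card_erase_of_mem hb, hBcard] at h4
    omega
  -- (iii) hence B is a clique (this is where `n ≥ 5` enters)
  have hBclique : IsClique Ls B := by
    intro b hb b' hb' hbb'
    by_contra hjb
    have hall : ∀ {b₁ b₂}, b₁ ∈ B → b₂ ∈ B → b₁ ≠ b₂ → b₂ ∉ U Ls b₁ →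
        ∀ z ∈ B, z ≠ b₁ → z ≠ b₂ → z ∈ U Ls b₁ := by
      intro b₁ b₂ hb₁ hb₂ h12 hj z hz hz1 hz2
      by_contra hzu
      have htwo : 2 ≤ ((B.erase b₁).filter fun z => z ∉ U Ls b₁).card := by
        have hsub : ({b₂, z} : Finset _) ⊆ (B.erase b₁).filter fun z => z ∉ U Ls b₁ := by
          intro w hw
          rcases mem_insert.mp hw with rfl | hw
          · exact mem_filter.mpr ⟨mem_erase.mpr ⟨Ne.symm h12, hb₂⟩, hj⟩
          · rw [mem_singleton] at hw; subst hw
            exact mem_filter.mpr ⟨mem_erase.mpr ⟨hz1, hz⟩, hzu⟩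
        have := card_le_card hsub
        rwa [card_pair (Ne.symm hz2)] at this
      have := hBB hb₁
      omega
    obtain ⟨hbx, -, -⟩ := hBmem hb
    obtain ⟨hb'x, -, -⟩ := hBmem hb'
    have hjoined : JE Ls b b' := by rwa [mem_U, not_not] at hjb
    have h2 := card_U_inter_of_joined hL hO hC hbb' hjoined
    have hsub : insert x ((B.erase b).erase b') ⊆ U Ls b ∩ U Ls b' := by
      intro z hz
      rcases mem_insert.mp hz with rfl | hz
      · exact mem_inter.mpr ⟨mem_U_comm.mp hbx, mem_U_comm.mp hb'x⟩
      · obtain ⟨hzb', hz⟩ := mem_erase.mp hz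
        obtain ⟨hzb, hzB⟩ := mem_erase.mp hz
        refine mem_inter.mpr ⟨hall hb hb' hbb' hjb z hzB hzb hzb', ?_⟩
        exact hall hb' hb (Ne.symm hbb') (fun h => hjb (mem_U_comm.mp h)) z hzB hzb' hzb
    have hxnot : x ∉ (B.erase b).erase b' := by
      intro hx
      have := (hBmem ((mem_erase.mp (mem_erase.mp hx).2).2)).1
      exact not_mem_U_self _ this
    have := card_le_card hsub
    rw [card_insert_of_notMem hxnot, card_erase_of_mem (mem_erase.mpr ⟨Ne.symm hbb', hb'⟩), card_erase_of_mem hb,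
      hBcard, h2] at this
    omega
  -- (iv) no unjoined pair across
  have hcross : ∀ a ∈ A, ∀ b ∈ B, b ∉ U Ls a := by
    intro a ha b hb hba
    obtain ⟨hbx, -, -⟩ := hBmem hb
    have hdeg := card_U_inter_of_unjoined hL hO hC (mem_U.mp hbx)
    have hsplit : (U Ls x ∩ U Ls b).card = (A.filter fun a => a ∈ U Ls b).card + (B.filter fun z => z ∈ U Ls b).card := by
      rw [← card_union_of_disjoint (disjoint_filter_filter hdisj), ← filter_union, hAB, filter_mem_eq_inter]
    have hBfull : (B.filter fun z => z ∈ U Ls b) = B.erase b := by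
      ext z; simp only [mem_filter, mem_erase]
      constructor
      · rintro ⟨hz, hu⟩; exact ⟨by rintro rfl; exact not_mem_U_self _ hu, hz⟩
      · rintro ⟨hzb, hz⟩; exact ⟨hz, hBclique b hb z hz (Ne.symm hzb)⟩
    rw [hBfull, card_erase_of_mem hb, hBcard] at hsplit
    have hpos : 0 < (A.filter fun a => a ∈ U Ls b).card :=
      card_pos.mpr ⟨a, mem_filter.mpr ⟨ha, mem_U_comm.mp hba⟩⟩
    omega
  -- (v) A is a clique
  have hAclique : IsClique Ls A := by
    intro a ha a' ha' haa'
    have hax : a ∈ U Ls x := hAsub ha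
    have hdeg := card_U_inter_of_unjoined hL hO hC (mem_U.mp hax)
    have hsub : U Ls x ∩ U Ls a ⊆ A.erase a := by
      intro z hz
      obtain ⟨hzx, hza⟩ := mem_inter.mp hz
      rw [← hAB, mem_union] at hzx
      rcases hzx with hzA | hzB
      · exact mem_erase.mpr ⟨by rintro rfl; exact not_mem_U_self _ hza, hzA⟩
      · exact absurd hza (hcross a ha z hzB)
    have heq : U Ls x ∩ U Ls a = A.erase a :=
      eq_of_subset_of_card_le hsub (by rw [card_erase_of_mem ha, hAcard]; omega)
    have : a' ∈ A.erase a := mem_erase.mpr ⟨Ne.symm haa', ha'⟩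
    rw [← heq] at this
    exact (mem_inter.mp this).2
  exact ⟨A, B, hAB, hdisj, hAcard, hBcard, hAclique, hBclique, hcross⟩
/-- **For a clique `K ∋ x` of `n` cells, the cells unjoined to `x` outside `K` form a clique with no unjoined pair to `K \ {x}`.** -/
theorem other_side (K : Finset (Fin n × Fin n)) (hK : IsClique Ls K) (hKc : K.card = n) {x : Fin n × Fin n} (hx : x ∈ K) :
    IsClique Ls (U Ls x \ K) ∧ (∀ a ∈ K.erase x, ∀ b ∈ U Ls x \ K, b ∉ U Ls a) ∧ (U Ls x \ K).card = n - 1 := by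
  obtain ⟨A, B, hAB, hdisj, hAc, hBc, hAcl, hBcl, hcross⟩ := local_structure hL hO hC hn x
  have hQsub : K.erase x ⊆ U Ls x := fun a ha => hK x hx a (mem_of_mem_erase ha) (ne_of_mem_erase ha).symm
  have hQc : (K.erase x).card = n - 1 := by rw [card_erase_of_mem hx, hKc]
  have hUK : U Ls x \ K = U Ls x \ K.erase x := by
    ext z; simp only [mem_sdiff, mem_erase, not_and]
    constructor
    · rintro ⟨hz, hzK⟩; exact ⟨hz, fun _ h => absurd h hzK⟩
    · rintro ⟨hz, h⟩; refine ⟨hz, fun hzK => ?_⟩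
      have := h ?_ hzK
      · exact this.elim
      · rintro rfl; exact not_mem_U_self _ hz
  rcases clique_eq_side hAB hAc hBc hcross (hK.mono (erase_subset x K)) hQsub hQc with hQ | hQ
  · -- K \ {x} = A, the other side is B
    have hother : U Ls x \ K = B := by
      rw [hUK, hQ, ← hAB, union_sdiff_left, sdiff_eq_self_of_disjoint hdisj.symm]
    rw [hother, hQ]
    exact ⟨hBcl, hcross, hBc⟩
  · have hother : U Ls x \ K = A := by
      rw [hUK, hQ, ← hAB, union_sdiff_right, sdiff_eq_self_of_disjoint hdisj]
    rw [hother, hQ]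
    exact ⟨hAcl, fun a ha b hb hba => hcross b hb a ha (mem_U_comm.mp hba), hAc⟩
/-- **A clique of `n` mutually unjoined cells exists.** -/
theorem exists_clique : ∃ K : Finset (Fin n × Fin n), IsClique Ls K ∧ K.card = n := by
  have h0 : 0 < n := by omega
  let x : Fin n × Fin n := (⟨0, h0⟩, ⟨0, h0⟩)
  obtain ⟨A, B, hAB, -, hAc, -, hAcl, -, -⟩ := local_structure hL hO hC hn x
  have hAsub : A ⊆ U Ls x := by rw [← hAB]; exact subset_union_left
  have hxA : x ∉ A := fun h => not_mem_U_self _ (hAsub h)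
  refine ⟨insert x A, ?_, by rw [card_insert_of_notMem hxA, hAc]; omega⟩
  intro a ha b hb hab
  rcases mem_insert.mp ha with rfl | ha
  · rcases mem_insert.mp hb with rfl | hb
    · exact absurd rfl hab
    · exact hAsub hb
  · rcases mem_insert.mp hb with rfl | hb
    · exact mem_U_comm.mp (hAsub ha)
    · exact hAcl a ha b hb hab

/-- **Every cell outside an `n`-clique `K` is unjoined to exactly one cell of `K`.** -/
theorem existsUnique_nbr_K (K : Finset (Fin n × Fin n)) (hK : IsClique Ls K) (hKc : K.card = n) {y : Fin n × Fin n}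
    (hy : y ∉ K) : ∃! x, x ∈ K ∧ y ∈ U Ls x := by
  have huniq : ∀ z, z ∉ K → ∀ x x', x ∈ K → z ∈ U Ls x → x' ∈ K → z ∈ U Ls x' → x = x' := by
    intro z hz x x' hx hzx hx' hzx'
    by_contra hxx
    obtain ⟨-, hcross, -⟩ := other_side hL hO hC hn K hK hKc hx
    exact hcross x' (mem_erase.mpr ⟨Ne.symm hxx, hx'⟩) z (mem_sdiff.mpr ⟨hzx, hz⟩) hzx'
  have hdisj : ∀ x ∈ K, ∀ x' ∈ K, x ≠ x' → Disjoint (U Ls x \ K) (U Ls x' \ K) := by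
    intro x hx x' hx' hxx
    rw [disjoint_left]
    intro z hz hz'
    exact hxx (huniq z (mem_sdiff.mp hz).2 x x' hx (mem_sdiff.mp hz).1 hx' (mem_sdiff.mp hz').1)
  have hcard : (K.biUnion fun x => U Ls x \ K).card = n * (n - 1) := by
    rw [card_biUnion hdisj, sum_congr rfl fun x hx => (other_side hL hO hC hn K hK hKc hx).2.2, sum_const, hKc,
      smul_eq_mul]
  have hsub : (K.biUnion fun x => U Ls x \ K) ⊆ Kᶜ := by
    intro z hz
    obtain ⟨x, -, hzx⟩ := mem_biUnion.mp hz
    exact mem_compl.mpr (mem_sdiff.mp hzx).2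
  have heq : (K.biUnion fun x => U Ls x \ K) = Kᶜ := by
    refine eq_of_subset_of_card_le hsub ?_
    rw [card_compl, Fintype.card_prod, Fintype.card_fin, hKc, hcard]
    obtain ⟨k, rfl⟩ : ∃ k, n = k + 1 := ⟨n - 1, by omega⟩
    rw [show k + 1 - 1 = k by omega]
    have : (k + 1) * (k + 1) = (k + 1) * k + (k + 1) := by ring
    omega
  have hyU : y ∈ K.biUnion fun x => U Ls x \ K := by rw [heq]; exact mem_compl.mpr hy
  obtain ⟨x, hx, hyx⟩ := mem_biUnion.mp hyU
  exact ⟨x, ⟨hx, (mem_sdiff.mp hyx).1⟩, fun x' ⟨hx', hyx'⟩ => huniq y hy x' x hx' hyx' hx (mem_sdiff.mp hyx).1⟩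
/-- the projection onto the clique: `y` itself if `y ∈ K`, else its unique unjoined partner in `K` -/
noncomputable def proj (K : Finset (Fin n × Fin n)) (hK : IsClique Ls K) (hKc : K.card = n) (y : Fin n × Fin n) :
    Fin n × Fin n :=
  if hy : y ∈ K then y else Classical.choose (existsUnique_nbr_K hL hO hC hn K hK hKc hy).exists
/-- `proj y ∈ K`, and `y` is `proj y` or unjoined to it outside `K` -/
theorem proj_spec (K : Finset (Fin n × Fin n)) (hK : IsClique Ls K) (hKc : K.card = n) (y : Fin n × Fin n) :
    proj hL hO hC hn K hK hKc y ∈ K ∧ (y = proj hL hO hC hn K hK hKc y ∨ y ∈ U Ls (proj hL hO hC hn K hK hKc y) \ K) := by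
  unfold proj
  split_ifs with hy
  · exact ⟨hy, Or.inl rfl⟩
  · have h := Classical.choose_spec (existsUnique_nbr_K hL hO hC hn K hK hKc hy).exists
    exact ⟨h.1, Or.inr (mem_sdiff.mpr ⟨h.2, hy⟩)⟩
/-- **cells with the same projection coincide or are unjoined** (the fibre `{x} ∪ (U x \ K)` is a clique) -/
theorem eq_or_unjoined_of_proj_eq (K : Finset (Fin n × Fin n)) (hK : IsClique Ls K) (hKc : K.card = n)
    {y y' : Fin n × Fin n} (h : proj hL hO hC hn K hK hKc y = proj hL hO hC hn K hK hKc y') : y = y' ∨ ¬ JE Ls y y' := by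
  obtain ⟨hx, hyx⟩ := proj_spec hL hO hC hn K hK hKc y
  obtain ⟨-, hy'x⟩ := proj_spec hL hO hC hn K hK hKc y'
  rw [← h] at hy'x
  set x := proj hL hO hC hn K hK hKc y
  obtain ⟨hcl, -, -⟩ := other_side hL hO hC hn K hK hKc hx
  by_cases hyy : y = y'
  · exact Or.inl hyy
  right
  rw [← mem_U]
  rcases hyx with hyx | hyx <;> rcases hy'x with hy'x | hy'x
  · exact absurd (hyx.trans hy'x.symm) hyy
  · rw [hyx]; exact (mem_sdiff.mp hy'x).1
  · rw [hy'x]; exact mem_U_comm.mp (mem_sdiff.mp hyx).1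
  · exact hcl y hyx y' hy'x hyy
/-- **Deficiency-two completion (Shrikhande):** for `n ≥ 5`, `n - 3` pairwise orthogonal Latin squares of order `n` have a
common orthogonal mate that is Latin. -/
theorem exists_completion_two : ∃ S : Fin n → Fin n → Fin n, IsLatinSquare S ∧ ∀ k, IsOrthogonalMate (Ls k) S := by
  obtain ⟨K, hK, hKc⟩ := exists_clique hL hO hC hn
  let S : Fin n × Fin n → Fin n := fun y => (proj hL hO hC hn K hK hKc y).1
  have key : ∀ {y y'}, S y = S y' → JE Ls y y' → y = y' := by
    intro y y' hS hj
    have hp : proj hL hO hC hn K hK hKc y = proj hL hO hC hn K hK hKc y' :=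
      row_injOn_clique K hK (proj_spec hL hO hC hn K hK hKc y).1 (proj_spec hL hO hC hn K hK hKc y').1 hS
    rcases eq_or_unjoined_of_proj_eq hL hO hC hn K hK hKc hp with h | h
    · exact h
    · exact absurd hj h
  refine ⟨fun i b => S (i, b), ⟨fun i => ?_, fun b => ?_⟩, fun k => ?_⟩
  · intro b b' e
    have := key e ⟨Sum.inr false, rfl⟩
    simpa using this
  · intro i i' e
    have := key e ⟨Sum.inr true, rfl⟩
    simpa using this
  · rintro ⟨i, b⟩ ⟨i', b'⟩ e
    simp only [Prod.mk.injEq] at e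
    exact key e.2 ⟨Sum.inl k, by simpa [coord, val] using e.1.symm⟩

end Two

/-! ### Consequences -/
/-- `n - 3` MOLS(n), `n ≥ 5`, extend to `n - 1` MOLS(n) (family on `Option (Option ι)`) -/
theorem exists_extension_two {ι : Type*} [Fintype ι] {n : ℕ} (Ls : ι → Fin n → Fin n → Fin n)
    (hL : ∀ k, IsLatinSquare (Ls k)) (hO : ∀ k k', k ≠ k' → IsOrthogonalMate (Ls k) (Ls k')) (hC : Fintype.card ι + 3 = n)
    (hn : 5 ≤ n) :
    ∃ Ms : Option (Option ι) → Fin n → Fin n → Fin n, (∀ k, IsLatinSquare (Ms k)) ∧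
      (∀ k k', k ≠ k' → IsOrthogonalMate (Ms k) (Ms k')) ∧ ∀ k, Ms (some (some k)) = Ls k := by
  obtain ⟨S, hS, hSO⟩ := exists_completion_two hL hO hC hn
  set Ns : Option ι → Fin n → Fin n → Fin n := fun o => o.elim S Ls with hNs
  have hNL : ∀ k, IsLatinSquare (Ns k) := by rintro (_ | k); exacts [hS, hL k]
  have hNO : ∀ k k', k ≠ k' → IsOrthogonalMate (Ns k) (Ns k') := by
    rintro (_ | k) (_ | k') hkk
    · exact absurd rfl hkk
    · exact isOrthogonalMate_symm (hSO k')
    · exact hSO k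
    · exact hO k k' fun e => hkk (congrArg some e)
  have hC' : Fintype.card (Option ι) + 2 = n := by rw [Fintype.card_option]; omega
  obtain ⟨Ms, hM, hMO, hMs⟩ := exists_extension Ns hNL hNO hC'
  exact ⟨Ms, hM, hMO, fun k => by rw [hMs, hNs]; rfl⟩
/-- **A projective plane of order `n ≥ 5` exists iff `n - 3` MOLS(n) exist** (Shrikhande 1961 + Bose). -/
theorem existsPlane_iff_MOLS_deficiency_two {n : ℕ} (hn : 5 ≤ n) :
    ExistsProjectivePlaneOrder n ↔ ∃ Ls : Fin (n - 3) → Fin n → Fin n → Fin n,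
      (∀ k, IsLatinSquare (Ls k)) ∧ ∀ k k', k ≠ k' → IsOrthogonalMate (Ls k) (Ls k') := by
  constructor
  · intro h
    obtain ⟨Ls, hL, hO⟩ := (existsPlane_iff_MOLS (by omega : 2 ≤ n)).1 h
    refine ⟨fun k => Ls (Fin.castLE (by omega) k), fun k => hL _, fun k k' hkk => hO _ _ fun e => hkk ?_⟩
    exact Fin.castLE_injective _ e
  · rintro ⟨Ls, hL, hO⟩
    have hC : Fintype.card (Fin (n - 3)) + 3 = n := by rw [Fintype.card_fin]; omega
    obtain ⟨Ms, hM, hMO, -⟩ := exists_extension_two Ls hL hO hC hn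
    have hι : Fintype.card (Option (Option (Fin (n - 3)))) + 1 = n := by
      rw [Fintype.card_option, Fintype.card_option, Fintype.card_fin]; omega
    exact ⟨MPt Ms, MLn Ms, inferInstance, inferInstance, inferInstance, planeOfMOLS hM hMO (by omega) hι,
      order_planeOfMOLS hM hMO (by omega) hι⟩

/-- **Target (M-b) needs only NINE squares:** a projective plane of order 12 exists iff there are nine pairwise orthogonal Latin
squares of order 12. -/
theorem existsPlaneOrder12_iff_nine_MOLS :
    ExistsProjectivePlaneOrder12 ↔ ∃ Ls : Fin 9 → Fin 12 → Fin 12 → Fin 12,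
      (∀ k, IsLatinSquare (Ls k)) ∧ ∀ k k', k ≠ k' → IsOrthogonalMate (Ls k) (Ls k') :=
  existsPlaneOrder12_iff.trans (existsPlane_iff_MOLS_deficiency_two (n := 12) (by norm_num))

/-- **The printed MOLS(10) upper floor, modulo Lam:** if there is no projective plane of order 10 then any family of pairwise
orthogonal Latin squares of order 10 has at most 6 members (`N(10) ≤ 6`). -/
theorem card_MOLS10_le_six_of_noPlane10 (hLam : ¬ ExistsProjectivePlaneOrder 10) {ι : Type*} [Fintype ι]
    (Ls : ι → Fin 10 → Fin 10 → Fin 10) (hL : ∀ k, IsLatinSquare (Ls k)) (hO : ∀ k k', k ≠ k' → IsOrthogonalMate (Ls k) (Ls k')) :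
    Fintype.card ι ≤ 6 := by
  have h7 := card_MOLS10_le_seven_of_noPlane10 hLam Ls hL hO
  by_contra hlt
  have hcard : Fintype.card ι = 7 := by omega
  obtain ⟨Ms, hM, hMO, -⟩ := exists_extension_two Ls hL hO (by rw [hcard]) (by norm_num)
  have h9 := card_MOLS10_le_seven_of_noPlane10 hLam Ms hM hMO
  rw [Fintype.card_option, Fintype.card_option, hcard] at h9
  omega

/-- likewise for order 12: without a projective plane of order 12 there are at most 8 MOLS(12) (the record is 5) -/
theorem card_MOLS12_le_eight_of_noPlane12 (h12 : ¬ ExistsProjectivePlaneOrder12) {ι : Type*} [Fintype ι]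
    (Ls : ι → Fin 12 → Fin 12 → Fin 12) (hL : ∀ k, IsLatinSquare (Ls k)) (hO : ∀ k k', k ≠ k' → IsOrthogonalMate (Ls k) (Ls k')) :
    Fintype.card ι ≤ 8 := by
  have h9 := card_MOLS12_le_nine_of_noPlane12 h12 Ls hL hO
  by_contra hlt
  have hcard : Fintype.card ι = 9 := by omega
  obtain ⟨Ms, hM, hMO, -⟩ := exists_extension_two Ls hL hO (by rw [hcard]) (by norm_num)
  have h11 := card_MOLS12_le_nine_of_noPlane12 h12 Ms hM hMO
  rw [Fintype.card_option, Fintype.card_option, hcard] at h11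
  omega

end Summit.Ventures.DiscreteObjects.MOLS
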